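import Literature.AlgebraicGeometry.Resolution.WeightedCentreCorollaryLF
import HarnessLib

/-!
# Weighted centres — COROLLARY L-F as ONE proposition per menu: `Iso(N, g)`, "(P)-menu of the setting", `CorollaryLFAt` (LF-MODEL §6.4 sentence 1, engine 1's phrasing)

Instrument for engine 1's `W(f)` TOY MODEL (cell `pub-rosobs`; LF-MODEL-eng1-g45 (S1)–(S5), §6.4; the bundled phrasing is engine 1's, CARVER-NOTES-eng1-g49 §2, adopted verbatim), NOT a
resolution theorem and NOT about the invariant of [AbramovichTemkinWlodarczyk2024].  AI-written, AI-gate-reviewed.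

This file only NAMES things already proved in `WeightedCentreCorollaryLF` (`ZKernel.eq_one_of_slotPinned`):
* `isoGroup w V g = graded w 1 ⊓ baseFixing ⊓ 𝔄_1 ⊓ fixSlots V ⊓ Stab(C g)` — the engine's `Iso(N, g)`: the `k[σ]`-automorphisms of `k[ε][σ]` that are `w`-graded of degree `1`
  (`wt σ = 1`), fix `k` and `σ`, are `≡ id (mod σ)`, are `= id` on `ε_V` (the XL normalisation, (S4)) and fix `g`;
* `MenuOfTheSetting p u w V g` — the hypothesis ledger (S1)–(S5) ↦ Lean: `k` perfect (used at the core only), `n!·u_n = 1 (n < p)`, positive rational weights (ANY number of light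
  weight-values `< p`, integral or not; no upper bound), `g` `w`-homogeneous of weight `v₀ = p(p+1)`, (P) in slot form at every slot of weight `≤ p + 1` (NOT at the `V`-classes:
  unused, CARVER-NOTES-eng1-g49 §1 (D3)), and `V` = the slots of weight `> p + 1` (`le_or_mem`, `lt_of_mem`);
* `NoPureWTermImpliesTrivial p w V g` — "every `A ∈ Iso(N, g)` whose pure `σ^p`-coefficient vanishes at every slot of weight `p` is the identity";
* `CorollaryLFAt p u w V g := MenuOfTheSetting p u w V g → NoPureWTermImpliesTrivial p w V g`, and THE THEOREM `corollaryLF : CorollaryLFAt p u w V g` for every menu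
  (`[Fact p.Prime] [CharP k p]`); the contrapositive `exists_pureCoeff_ne_zero` ("`A ≠ 1` has a pure `σ^p` `W`-term"), `W = ∅ ⇒ Iso(N, g) = ⊥` (`isoGroup_eq_bot_of_forall_ne`), and the
  canonical menu `canonicalV p w = {i | p + 1 < w i}` (`menuOfTheSetting_canonicalV`).

References: [AbramovichTemkinWlodarczyk2024, §5.1 (p. 1575), Thm. 5.3.1 (2)–(3) (p. 1578)]; [Lang2002, Ch. I §3, Ch. IV §1, Ch. XIII §4]; [Matsumura1987, §27 (pp. 207–209)].
-/

namespace Literature.AlgebraicGeometry.Resolution.WeightedBlowup.ZKernel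

open Polynomial OrderFiltration LevelProjection Truncation

section Defs

variable {k : Type*} [Field k] {ι : Type*}

/-- **`Iso(N, g)`** of the `W(f)` toy model (LF-MODEL-eng1-g45 (S4); engine 1's phrasing, CARVER-NOTES-eng1-g49 §2): the `k[σ]`-automorphisms of `k[ε][σ]` that are `w`-graded of
degree `1`, fix `k` and `σ`, are `≡ id (mod σ)`, are `= id` on `ε_V`, and fix `C g` — `graded w 1 ⊓ baseFixing ⊓ 𝔄_1 ⊓ fixSlots V ⊓ Stab(C g)`.  Instrument for engine 1's `W(f)` toy model,
NOT a resolution theorem. [cite: AbramovichTemkinWlodarczyk2024, §5.1 (p. 1575); Lang2002, Ch. I §3, Ch. XIII §4] -/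
noncomputable def isoGroup (w : ι → ℚ) (V : Set ι) (g : MvPolynomial ι k) : Subgroup ((MvPolynomial ι k)[X] ≃+* (MvPolynomial ι k)[X]) :=
  graded w (1 : ℚ) ⊓ baseFixing ⊓ level (X : (MvPolynomial ι k)[X]) 1 ⊓ fixSlots V ⊓
    MulAction.stabilizer ((MvPolynomial ι k)[X] ≃+* (MvPolynomial ι k)[X]) (C g : (MvPolynomial ι k)[X])

/-- Membership in `Iso(N, g)` spelled out (bookkeeping). [cite: Lang2002, Ch. I §3] -/
theorem mem_isoGroup {w : ι → ℚ} {V : Set ι} {g : MvPolynomial ι k} {A : (MvPolynomial ι k)[X] ≃+* (MvPolynomial ι k)[X]} :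
    A ∈ isoGroup w V g ↔ A ∈ graded w (1 : ℚ) ∧ A ∈ baseFixing ∧ A ∈ level (X : (MvPolynomial ι k)[X]) 1 ∧ A ∈ fixSlots (k := k) V ∧ A (C g) = C g := by
  simp only [isoGroup, Subgroup.mem_inf, MulAction.mem_stabilizer_iff, RingAut.smul_def, and_assoc]

/-- **A (P)-menu of the setting** (LF-MODEL-eng1-g45 (S1)–(S5) as the typed chain consumes them; engine 1's hypothesis ledger, CARVER-NOTES-eng1-g49 §2): `k` perfect (`perfect`, used at
the core only), `n!·u_n = 1 (n < p)` (`units`), positive rational weights (`pos`; any number of light weight-values, integral or not), `g` `w`-homogeneous of weight `p(p+1)` (`homog`),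
(P) in slot form at every slot of weight `≤ p + 1` (`pinned`; NOT at the `V`-classes), `V` = the slots of weight `> p + 1` (`le_or_mem`, `lt_of_mem`).  Dropped from the model as unused:
`p` odd, the upper bound `w ≤ v₀/2`, `g ≠ 0`, "monomials of degree `≥ 2`".  Instrument for engine 1's `W(f)` toy model, NOT a resolution theorem.
[cite: AbramovichTemkinWlodarczyk2024, §5.1 (p. 1575), Thm. 5.3.1 (2)–(3) (p. 1578); Matsumura1987, §27 (pp. 207–209)] -/
structure MenuOfTheSetting (p : ℕ) (u : ℕ → k) (w : ι → ℚ) (V : Set ι) (g : MvPolynomial ι k) : Prop where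
  perfect : ∀ x : k, ∃ y : k, y ^ p = x
  units : ∀ n < p, (Nat.factorial n : k) * u n = 1
  pos : ∀ i, 0 < w i
  homog : MvPolynomial.IsWeightedHomogeneous w g ((p : ℚ) * (p + 1))
  pinned : ∀ l, w l ≤ (p : ℚ) + 1 → SlotPinned w l g
  le_or_mem : ∀ i, w i ≤ (p : ℚ) + 1 ∨ i ∈ V
  lt_of_mem : ∀ i ∈ V, (p : ℚ) + 1 < w i

/-- **"No pure `σ^p` `W`-term ⇒ trivial"** (the conclusion of COROLLARY L-F, LF-MODEL-eng1-g45 §6.4 sentence 1): every `A ∈ Iso(N, g)` whose pure `σ^p`-coefficient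
`pureCoeff A n p` vanishes at every slot `n` of weight `p` is the identity.  Instrument for engine 1's `W(f)` toy model, NOT a resolution theorem.
[cite: AbramovichTemkinWlodarczyk2024, Thm. 5.3.1 (2)–(3) (p. 1578); Lang2002, Ch. IV §1] -/
def NoPureWTermImpliesTrivial (p : ℕ) (w : ι → ℚ) (V : Set ι) (g : MvPolynomial ι k) : Prop :=
  ∀ A ∈ isoGroup w V g, (∀ n, w n = p → pureCoeff (A : (MvPolynomial ι k)[X] →+* (MvPolynomial ι k)[X]) n p = 0) → A = 1

/-- **COROLLARY L-F at one menu** (LF-MODEL-eng1-g45 §6.4 sentence 1, engine 1's phrasing): `MenuOfTheSetting p u w V g → NoPureWTermImpliesTrivial p w V g`.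
Instrument for engine 1's `W(f)` toy model, NOT a resolution theorem. [cite: AbramovichTemkinWlodarczyk2024, §5.1 (p. 1575), Thm. 5.3.1 (2)–(3) (p. 1578)] -/
def CorollaryLFAt (p : ℕ) (u : ℕ → k) (w : ι → ℚ) (V : Set ι) (g : MvPolynomial ι k) : Prop :=
  MenuOfTheSetting p u w V g → NoPureWTermImpliesTrivial p w V g

/-- The canonical `V` of a weight vector: the slots of weight `> p + 1` (LF-MODEL-eng1-g45 (S2); CARVER-NOTES-eng1-g49 §1 (D1)).  Instrument for engine 1's `W(f)` toy model.
[cite: AbramovichTemkinWlodarczyk2024, §5.1 (p. 1575)] -/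
def canonicalV (p : ℕ) (w : ι → ℚ) : Set ι := {i | (p : ℚ) + 1 < w i}

/-- The canonical `V` satisfies both `V`-hypotheses of a menu (bookkeeping). [cite: AbramovichTemkinWlodarczyk2024, §5.1 (p. 1575)] -/
theorem le_or_mem_canonicalV (p : ℕ) (w : ι → ℚ) (i : ι) : w i ≤ (p : ℚ) + 1 ∨ i ∈ canonicalV p w :=
  (le_or_gt (w i) ((p : ℚ) + 1)).imp_right id

/-- The canonical `V` satisfies both `V`-hypotheses of a menu (bookkeeping). [cite: AbramovichTemkinWlodarczyk2024, §5.1 (p. 1575)] -/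
theorem lt_of_mem_canonicalV (p : ℕ) (w : ι → ℚ) (i : ι) (hi : i ∈ canonicalV p w) : (p : ℚ) + 1 < w i := hi

/-- A menu with the canonical `V`: the five remaining hypotheses suffice (bookkeeping). [cite: AbramovichTemkinWlodarczyk2024, §5.1 (p. 1575), Thm. 5.3.1 (2)–(3) (p. 1578)] -/
theorem menuOfTheSetting_canonicalV {p : ℕ} {u : ℕ → k} {w : ι → ℚ} {g : MvPolynomial ι k} (hperf : ∀ x : k, ∃ y : k, y ^ p = x)
    (hu : ∀ n < p, (Nat.factorial n : k) * u n = 1) (hw : ∀ i, 0 < w i) (hg : MvPolynomial.IsWeightedHomogeneous w g ((p : ℚ) * (p + 1)))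
    (hP : ∀ l, w l ≤ (p : ℚ) + 1 → SlotPinned w l g) : MenuOfTheSetting p u w (canonicalV p w) g :=
  ⟨hperf, hu, hw, hg, hP, le_or_mem_canonicalV p w, lt_of_mem_canonicalV p w⟩

end Defs

section Theorem

variable {k : Type*} [Field k] {ι : Type*} [Fintype ι] [DecidableEq ι] (p : ℕ) [Fact p.Prime] [CharP k p]

/-- **COROLLARY L-F** (= CONJECTURE L-F of the `W(f)` toy model on every (P)-menu of the setting, `k` perfect; LF-MODEL-eng1-g45 §6.4 sentence 1 in engine 1's phrasing,
CARVER-NOTES-eng1-g49 §2): `CorollaryLFAt p u w V g` holds for every menu.  Proof: `ZKernel.eq_one_of_slotPinned` (the restriction tower composed by induction on the number of light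
slots, each storey THEOREM A⁺ + THEOREM B, the core THEOREM F★).  Instrument for engine 1's `W(f)` toy model, NOT a resolution theorem, NOT about the invariant of [AbramovichTemkinWlodarczyk2024].
[cite: AbramovichTemkinWlodarczyk2024, §5.1 (p. 1575), Thm. 5.3.1 (2)–(3) (p. 1578); Lang2002, Ch. I §3, Ch. IV §1, Ch. XIII §4; Matsumura1987, §27 (pp. 207–209)] -/
theorem corollaryLF (u : ℕ → k) (w : ι → ℚ) (V : Set ι) (g : MvPolynomial ι k) : CorollaryLFAt p u w V g := fun N A hA hW => by
  obtain ⟨hgr, hb, h1, hV, hfix⟩ := mem_isoGroup.mp hA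
  exact eq_one_of_slotPinned p N.perfect N.units N.pos N.homog N.pinned N.le_or_mem N.lt_of_mem hgr hb h1 hV hfix hW

/-- COROLLARY L-F, conclusion form: a (P)-menu of the setting has `NoPureWTermImpliesTrivial`.  Instrument for engine 1's `W(f)` toy model, NOT a resolution theorem.
[cite: AbramovichTemkinWlodarczyk2024, Thm. 5.3.1 (2)–(3) (p. 1578)] -/
theorem noPureWTermImpliesTrivial {u : ℕ → k} {w : ι → ℚ} {V : Set ι} {g : MvPolynomial ι k} (N : MenuOfTheSetting p u w V g) :
    NoPureWTermImpliesTrivial p w V g :=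
  corollaryLF p u w V g N

/-- **COROLLARY L-F, contrapositive** (LF-MODEL-eng1-g45 §6.4: "every `X ∈ Iso(N, g) ∖ {id}` has a pure `σ^p`-term on some `W`-slot"): for a (P)-menu of the setting, a non-trivial
`A ∈ Iso(N, g)` has a slot `n` of weight `p` with `pureCoeff A n p ≠ 0`.  Instrument for engine 1's `W(f)` toy model, NOT a resolution theorem.
[cite: AbramovichTemkinWlodarczyk2024, Thm. 5.3.1 (2)–(3) (p. 1578); Lang2002, Ch. IV §1] -/
theorem exists_pureCoeff_ne_zero {u : ℕ → k} {w : ι → ℚ} {V : Set ι} {g : MvPolynomial ι k} (N : MenuOfTheSetting p u w V g)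
    {A : (MvPolynomial ι k)[X] ≃+* (MvPolynomial ι k)[X]} (hA : A ∈ isoGroup w V g) (hA1 : A ≠ 1) :
    ∃ n, w n = p ∧ pureCoeff (A : (MvPolynomial ι k)[X] →+* (MvPolynomial ι k)[X]) n p ≠ 0 := by
  by_contra h
  push Not at h
  exact hA1 (corollaryLF p u w V g N A hA fun n hn => h n hn)

/-- **`W = ∅ ⇒ Iso(N, g) = {id}`** (LF-MODEL-eng1-g45 §6.4 sentence 1, second clause; LEMMA F∅ in general): for a (P)-menu of the setting with no slot of weight `p`, `isoGroup w V g = ⊥`.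
Instrument for engine 1's `W(f)` toy model, NOT a resolution theorem. [cite: AbramovichTemkinWlodarczyk2024, Thm. 5.3.1 (2)–(3) (p. 1578); Lang2002, Ch. I §3] -/
theorem isoGroup_eq_bot_of_forall_ne {u : ℕ → k} {w : ι → ℚ} {V : Set ι} {g : MvPolynomial ι k} (N : MenuOfTheSetting p u w V g) (hW : ∀ n, w n ≠ p) :
    isoGroup w V g = ⊥ :=
  (Subgroup.eq_bot_iff_forall _).mpr fun A hA => corollaryLF p u w V g N A hA fun n hn => absurd hn (hW n)

/-- **COROLLARY L-F for the canonical menu** (`V := {i | p + 1 < w i}`): the five hypotheses `k` perfect, `n!·u_n = 1 (n < p)`, `0 < w`, `g` homogeneous of weight `p(p+1)`, (P) at weight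
`≤ p + 1` give `NoPureWTermImpliesTrivial p w (canonicalV p w) g`.  Instrument for engine 1's `W(f)` toy model, NOT a resolution theorem.
[cite: AbramovichTemkinWlodarczyk2024, §5.1 (p. 1575), Thm. 5.3.1 (2)–(3) (p. 1578); Matsumura1987, §27 (pp. 207–209)] -/
theorem noPureWTermImpliesTrivial_canonicalV {u : ℕ → k} {w : ι → ℚ} {g : MvPolynomial ι k} (hperf : ∀ x : k, ∃ y : k, y ^ p = x)
    (hu : ∀ n < p, (Nat.factorial n : k) * u n = 1) (hw : ∀ i, 0 < w i) (hg : MvPolynomial.IsWeightedHomogeneous w g ((p : ℚ) * (p + 1)))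
    (hP : ∀ l, w l ≤ (p : ℚ) + 1 → SlotPinned w l g) : NoPureWTermImpliesTrivial p w (canonicalV p w) g :=
  corollaryLF p u w _ g (menuOfTheSetting_canonicalV hperf hu hw hg hP)

end Theorem

end Literature.AlgebraicGeometry.Resolution.WeightedBlowup.ZKernel
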